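import Literature.Analysis.FluidPDE.PeriodicLogSlice
import Literature.Analysis.FluidPDE.PeriodicEnergyPackage
import Literature.Analysis.FluidPDE.PeriodicHalfBoxMass
import Literature.Analysis.FluidPDE.PeriodicNashPoincare
import Literature.Analysis.FluidPDE.LeiZhang2011TimeArgument
import Literature.Analysis.FluidPDE.LeiZhang2011Cutoff
import Literature.Analysis.FluidPDE.NashNonlinearities
import HarnessLib

/-!
# Lei–Ren–Zhang 2019, Lemma 3.1 (tree form): the logarithmic estimate per period

Analysis/FluidPDE proofs file (theorems only, no definitions, no named facts), on the discharge
path of the named fact `Literature.Analysis.FluidPDE.leiRenZhang2019_liouville_periodic`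
(Z. Lei, X. Ren, Q. S. Zhang, arXiv:1902.11229 = Math. Ann. 383 (2022), Theorem 1.1). Lemma 3.1 of
the paper (arXiv p. 7): "Let `Φ ≤ 1` be a positive `z`-periodic solution to (1.6) in `P_R`
(`R ≥ 1`) which satisfies `‖Φ‖_{L¹(P(R/2))} ≥ κR⁴` for some `κ > 0`. Moreover we assume that
`Φ|_{r=0} ≥ ½`. Then there holds `−∫ ζ_R²(x) ln Φ(x,t) dx ≤ MR²` for all `t ∈ [−κR²/4, 0]` and
some positive constant `M` depending only on `κ`." This file is the periodic twin of
`LeiZhang2011.log_estimate`: the slice inequality (3.8) (`log_slice_bound_periodic`), the slab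
energy functional as an absolutely continuous function of time (`slab_energy_package_periodic`),
the Nash–Poincaré lower bound on the set `W` of times of large mass ((3.9)–(3.12),
`nash_poincare_lower_periodic`, `slab_mass_of_quarter_mass_periodic`), and the time argument
((3.12)–(3.13), the tree's `LeiZhang2011.le_threshold_or_riccati`, unchanged). As in the tree's
Lei–Zhang chain the mass hypothesis is taken in `L^{1/4}` form (the output of Lemma 3.3,
`lower_mass_periodic`), and the constants depend on the angular-potential constant `C_Φ`
(through the slice inequality) and the mass constant.

* `log_estimate_periodic`.

## References

* Z. Lei, X. Ren, Q. S. Zhang, arXiv:1902.11229, §3, Lemma 3.1 and its proof, (3.8)–(3.13)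
  (arXiv pp. 7–8). [LeiRenZhang2019]
* Z. Lei, Q. S. Zhang, arXiv:1011.5066, Lemma 3.2 (pp. 9–10) (tree `LeiZhang2011.log_estimate`).
  [LeiZhang2011]
-/

noncomputable section

open MeasureTheory Set Function Filter Metric intervalIntegral
open _root_.Topology
open scoped InnerProductSpace RealInnerProductSpace NNReal ENNReal Laplacian

namespace Literature.Analysis.FluidPDE

namespace LeiRenZhang2019

open LeiZhang2011 Literature.Analysis.Pluripotential

set_option maxHeartbeats 1600000 in
-- one long assembly proof (cut-off, the clamped logarithm, the slab energy package, the slice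
-- inequality, the set `W`, the Nash–Poincaré step on `W`, the time argument, constants)
/-- **Lemma 3.1 of Lei–Ren–Zhang 2019 (tree form): the logarithmic estimate per period.** For
every angular-potential constant `C_Φ ≥ 0` and every mass constant `m₀ > 0` there are
`c_t ∈ (0, 1/8]` and `M₀ ≥ 0` such that for every period `P > 0`, every radius `ρ ≥ P`, every
`0 < ε ≤ 1` and every solution `F` in the periodic swirl setting at radius `ρ` (hypotheses as in
`lower_mass_periodic`) with `ε ≤ F ≤ 3` on `[−ρ², 0] × {r ≤ ρ}`, `F ≥ 1` at the axis points and
the mass bound `∫_{−ρ²/4}^0 ∫_{{0≤x₂≤P, r≤ρ/2}} F^{1/4} ≥ m₀Pρ⁴` (the output of Lemma 3.3), one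
has `∫_{zSlab P 0} (−ln F(t,·)) ζ² ≤ M₀ Pρ²` for all `t ∈ [−c_tρ², 0]`, `ζ = cylCutoff (ρ/2) ρ`
(printed: "`−∫ζ_R²(x) ln Φ(x,t)dx ≤ MR²` for all `t ∈ [−κR²/4, 0]`", period `Z₀ = 1`). [cite: LeiRenZhang2019, §3, Lemma 3.1 (arXiv pp. 7–8)] -/
theorem log_estimate_periodic {CΦ : ℝ} (hCΦ : 0 ≤ CΦ) {m₀ : ℝ} (hm₀ : 0 < m₀) :
    ∃ ct M₀ : ℝ, 0 < ct ∧ ct ≤ 1 / 8 ∧ 0 ≤ M₀ ∧ ∀ ⦃P : ℝ⦄, 0 < P → ∀ ⦃ρ : ℝ⦄, P ≤ ρ →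
      ∀ ⦃ε : ℝ⦄, 0 < ε → ε ≤ 1 →
      ∀ ⦃F N : ℝ → EuclideanSpace ℝ (Fin 3) → ℝ⦄
        ⦃b : ℝ → EuclideanSpace ℝ (Fin 3) → EuclideanSpace ℝ (Fin 3)⦄
        ⦃Φ : ℝ → EuclideanSpace ℝ (Fin 3) → ℝ⦄,
      (∀ s, ContDiff ℝ 2 (F s)) → (∀ s, IsAxisymmetricScalar (F s)) →
      (∀ s, IsAxiallyPeriodic P (F s)) →
      (∀ s, ContDiff ℝ 1 (b s)) → (∀ s x, VectorCalculus.divergence (b s) x = 0) →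
      (∀ s, IsAxiallyPeriodic P (b s)) →
      (∀ s, ContDiff ℝ 1 (Φ s)) → (∀ s, IsAxiallyPeriodic P (Φ s)) →
      (∀ s x, fderiv ℝ (Φ s) x eZ = ⟪b s x, horizPart x⟫) →
      (∀ s x, |Φ s x| ≤ CΦ * cylRadius x) →
      (∀ s x, N s x =
        (Δ (F s)) x - fderiv ℝ (F s) x (b s x) - 2 / cylRadius x * fderiv ℝ (F s) x (eR x)) →
      (∀ᵐ x ∂(volume : Measure (EuclideanSpace ℝ (Fin 3))),
        IntervalIntegrable (fun s => N s x) volume (-ρ ^ 2) 0 ∧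
          ∀ s ∈ Icc (-ρ ^ 2) 0, F s x = F (-ρ ^ 2) x + ∫ τ in (-ρ ^ 2)..s, N τ x) →
      (Continuous fun p : ℝ × EuclideanSpace ℝ (Fin 3) => F p.1 p.2) →
      AEStronglyMeasurable (fun p : ℝ × EuclideanSpace ℝ (Fin 3) => N p.1 p.2)
        ((volume.restrict (Ioc (-ρ ^ 2) 0)).prod volume) →
      Integrable (fun p : ℝ × EuclideanSpace ℝ (Fin 3) => N p.1 p.2)
        ((volume.restrict (Ioc (-ρ ^ 2) 0)).prod
          (volume.restrict {x : EuclideanSpace ℝ (Fin 3) | x 2 ∈ Icc 0 (2 * P) ∧ cylRadius x ≤ ρ})) →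
      (∀ s ∈ Icc (-ρ ^ 2) 0, ∀ x, cylRadius x ≤ ρ → ε ≤ F s x ∧ F s x ≤ 3) →
      (∀ s ∈ Icc (-ρ ^ 2) 0, ∀ z : ℝ, 1 ≤ F s (meridianPoint (0, z))) →
      m₀ * (P * ρ ^ 4) ≤ ∫ s in (-(ρ ^ 2 / 4))..0,
        ∫ x in {x : EuclideanSpace ℝ (Fin 3) | x 2 ∈ Icc 0 P ∧ cylRadius x ≤ ρ / 2}, F s x ^ (1 / 4 : ℝ) →
      ∀ t ∈ Icc (-(ct * ρ ^ 2)) 0,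
        ∫ x in zSlab P 0, -Real.log (F t x) * cylCutoff (ρ / 2) ρ x ^ 2 ≤ M₀ * (P * ρ ^ 2) := by
  -- ### the absolute constants
  obtain ⟨Cφ, hCφ0, hCφ⟩ := exists_norm_gradient_cylCutoff_le
  obtain ⟨CT, hCT0, hCT⟩ := exists_abs_deriv_smoothTransition_le
  have hc₂ : 0 < radialConst₂ := radialConst₂_pos
  have hlog3 : 0 < Real.log 3 := Real.log_pos (by norm_num)
  -- the derived constants (all depending only on `C_Φ`, `m₀` and absolute constants)
  set k₁ : ℝ := 96 * Cφ ^ 2 * (1 + CΦ ^ 2) + 2097152 / 3 * CT ^ 2 with hk₁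
  set kK : ℝ := k₁ + 2 * radialConst₂ * Real.log 3 with hkK
  set θ₀ : ℝ := 2 * m₀ with hθ₀
  set m₁ : ℝ := 16 / 27 * θ₀ ^ 4 with hm₁
  set w₀ : ℝ := m₁ / 4 with hw₀
  set L₀ : ℝ := |Real.log w₀| + 1 with hL₀
  set γ : ℝ := m₀ / 6 with hγ
  set ct : ℝ := min (γ / 2) (1 / 8) with hct
  set M₀ : ℝ := 2 * k₁ / radialConst₂ + 8 * L₀ + 589824 / (w₀ ^ 2 * γ) + kK with hM₀
  have hk₁0 : 0 ≤ k₁ := by positivity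
  have hkK0 : 0 ≤ kK := by positivity
  have hθ₀0 : 0 < θ₀ := by positivity
  have hm₁0 : 0 < m₁ := by positivity
  have hw₀0 : 0 < w₀ := by positivity
  have hL₀0 : 0 < L₀ := by positivity
  have hL₀' : -Real.log w₀ ≤ L₀ := (neg_le_abs _).trans (le_add_of_nonneg_right zero_le_one)
  have hγ0 : 0 < γ := by positivity
  have hct0 : 0 < ct := lt_min (by positivity) (by norm_num)
  have hM₀0 : 0 ≤ M₀ := by positivity
  refine ⟨ct, M₀, hct0, min_le_right _ _, hM₀0, ?_⟩
  intro P hP ρ hPρ ε hε hε1 F N b Φ hF2 hFa hFp hb1 hbdiv hbp hΦ1 hΦp hΦz hΦb hN heq hFc hNm hNi hFb hFax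
    hmass t ht
  -- ### elementary facts
  have hρ : 0 < ρ := hP.trans_le hPρ
  have hn0 : -ρ ^ 2 ≤ (0 : ℝ) := by nlinarith
  have hρ2 : 0 ≤ ρ / 2 := by positivity
  have hρ2' : 0 < ρ / 2 := by positivity
  have hρρ : ρ / 2 < ρ := half_lt_self hρ
  have hq0 : -(ρ ^ 2 / 4) ≤ (0 : ℝ) := by nlinarith
  have hq1 : -ρ ^ 2 ≤ -(ρ ^ 2 / 4) := by nlinarith
  set K₂ : Set (EuclideanSpace ℝ (Fin 3)) := {x | x 2 ∈ Icc 0 P ∧ cylRadius x ≤ ρ / 2} with hK₂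
  obtain ⟨hK₂top, hVlo, hVhi⟩ := volume_real_halfPeriodBox hP hρ
  have hK₂c : IsCompact K₂ := isCompact_halfPeriodBox P (ρ / 2)
  have hK₂m : MeasurableSet K₂ := hK₂c.isClosed.measurableSet
  have hVpos : 0 < volume.real K₂ := lt_of_lt_of_le (by positivity) hVlo
  -- ### the nonlinearity `H = −log ∘ χ_ε`
  obtain ⟨hHC, hHeq0, hHd10, hHd20⟩ := clampedNegLog_props hε
  obtain ⟨H, hHdef⟩ : ∃ H : ℝ → ℝ, ∀ v, H v = -Real.log (smoothMax (ε / 4) v (ε / 4)) := ⟨_, fun _ => rfl⟩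
  have hHfun : (fun v : ℝ => -Real.log (smoothMax (ε / 4) v (ε / 4))) = H := funext fun v => (hHdef v).symm
  rw [hHfun] at hHC hHd10 hHd20
  have hHeq : ∀ v, ε / 2 ≤ v → H v = -Real.log v := fun v hv => by rw [hHdef]; exact hHeq0 v hv
  have hH : ContDiff ℝ 2 H := hHC 2
  have hH1 : ContDiff ℝ 1 H := hHC 1
  -- ### the cut-off `ζ = cylCutoff (ρ/2) ρ` and its two masses
  obtain ⟨hZlo, hZhi, -⟩ := cylCutoff_sq_slab_mass hP hρ
  set φ : EuclideanSpace ℝ (Fin 3) → ℝ := cylCutoff (ρ / 2) ρ with hφdef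
  have hφ : ContDiff ℝ 2 φ := contDiff_cylCutoff _ _
  have hφa : IsAxisymmetricScalar φ := isAxisymmetricScalar_cylCutoff _ _
  have hφz : ∀ (x : EuclideanSpace ℝ (Fin 3)) (t : ℝ), φ (x + t • eZ) = φ x := cylCutoff_add_smul_eZ _ _
  have hφ1 : ∀ x, cylRadius x ≤ ρ / 2 → φ x = 1 := fun x hx => cylCutoff_eq_one hρ2 hρρ hx
  have hφ0 : ∀ x, ρ ≤ cylRadius x → φ x = 0 := fun x hx => cylCutoff_eq_zero hρ2 hρρ hx
  have hφ01 : ∀ x, 0 ≤ φ x ∧ φ x ≤ 1 := fun x => ⟨cylCutoff_nonneg _ _ _, cylCutoff_le_one _ _ _⟩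
  have hφb : ∀ x, |φ x| ≤ 1 := fun x => by rw [abs_of_nonneg (hφ01 x).1]; exact (hφ01 x).2
  obtain ⟨a, ha, haz, -, hφg⟩ := exists_gradient_cylCutoff_eq_smul_horizPart (ρ / 2) ρ
  obtain ⟨Z, hZdef⟩ : ∃ Z : ℝ, Z = ∫ y in zSlab P 0, φ y ^ 2 := ⟨_, rfl⟩
  rw [← hZdef] at hZlo hZhi
  have hZV : Z ≤ 4 * ρ ^ 2 * P := hZhi
  have hZpos : 0 < Z := lt_of_lt_of_le (by positivity) hZlo
  set A : ℝ := 2 * radialConst₂ * P with hAdef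
  have hApos : 0 < A := by positivity
  -- ### the slab energy package: `R` integrable in time, `Y(s₂) − Y(s₁) = ∫ R`
  obtain ⟨Rf, hRf⟩ : ∃ Rf : ℝ → ℝ, ∀ s, Rf s =
      -(∫ x in zSlab P 0, (deriv (deriv H) (F s x) * ‖gradient (F s) x‖ ^ 2 * φ x ^ 2 +
          deriv H (F s x) * ⟪gradient (F s) x, gradient (fun y => φ y ^ 2) x⟫)) +
        (∫ x in zSlab P 0, H (F s x) * ⟪b s x, gradient (fun y => φ y ^ 2) x⟫) +
        ((∫ x in zSlab P 0, 2 / cylRadius x * (H (F s x) * fderiv ℝ (fun y => φ y ^ 2) x (eR x))) +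
          2 * radialConst₂ * (φ 0 ^ 2 * ∫ z in (0 : ℝ)..P, H (F s (meridianPoint (0, z))))) :=
    ⟨_, fun _ => rfl⟩
  obtain ⟨Yf, hYf⟩ : ∃ Yf : ℝ → ℝ, ∀ s, Yf s = ∫ x in zSlab P 0, H (F s x) * φ x ^ 2 := ⟨_, fun _ => rfl⟩
  obtain ⟨Gf, hGf⟩ : ∃ Gf : ℝ → ℝ, ∀ s, Gf s =
      ∫ x in zSlab P 0, deriv H (F s x) ^ 2 * ‖gradient (F s) x‖ ^ 2 * φ x ^ 2 := ⟨_, fun _ => rfl⟩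
  have hGf0 : ∀ s, 0 ≤ Gf s := fun s => by
    rw [hGf]; exact setIntegral_nonneg (measurableSet_zSlab P 0) fun x _ => by positivity
  obtain ⟨hRi0, hY0⟩ := slab_energy_package_periodic hP le_rfl hF2 hFa hFp hb1 hbdiv hbp hN heq hFc hNm hNi hH
    hφ hφa hφz hρ2' hφ1 hφ0 hφb (ha 0).continuous haz hφg
  have hRi : IntervalIntegrable Rf volume (-ρ ^ 2) 0 := by
    refine hRi0.congr_ae (ae_of_all _ fun s => ?_)
    exact (hRf s).symm
  have hY : ∀ s₁ s₂, -ρ ^ 2 ≤ s₁ → s₁ ≤ s₂ → s₂ ≤ 0 → Yf s₂ - Yf s₁ = ∫ s in s₁..s₂, Rf s := by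
    intro s₁ s₂ h1 h12 h2
    rw [hYf, hYf, hY0 s₁ s₂ h1 h12 h2]
    exact intervalIntegral.integral_congr fun s _ => (hRf s).symm
  -- ### the slice inequality, for every `s ∈ [−ρ², 0]`
  have hslice : ∀ s ∈ Icc (-ρ ^ 2) 0, Rf s ≤ -(1 / 2) * Gf s + k₁ * P - A / Z * Yf s := by
    intro s hs
    have h := log_slice_bound_periodic hP hPρ hε (hF2 s) (hFp s) (hFb s hs) (hFax s hs) hH hHeq hHd10 hHd20
      (hb1 s) (hbp s) (hΦ1 s) (hΦp s) (hΦz s) hCΦ (hΦb s) hCφ hCT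
    rw [hRf, hGf, hYf, hAdef, hZdef, hk₁]
    exact h
  -- `Y ≥ −(log 3) Z` on the cylinder
  have hφ2c : Continuous fun y => φ y ^ 2 := hφ.continuous.pow 2
  have hslici : ∀ s, IntegrableOn (fun x => H (F s x) * φ x ^ 2) (zSlab P 0) volume := fun s =>
    integrableOn_zSlab_of_eq_zero_of_le_cylRadius ((hH.continuous.comp (hF2 s).continuous).mul hφ2c) (ρ := ρ)
      (fun x hx => by simp [hφ0 x hx]) P 0
  have hZi : IntegrableOn (fun x => φ x ^ 2) (zSlab P 0) volume :=
    integrableOn_zSlab_of_eq_zero_of_le_cylRadius hφ2c (ρ := ρ) (fun x hx => by simp [hφ0 x hx]) P 0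
  have hYlo : ∀ s ∈ Icc (-ρ ^ 2) 0, -(Real.log 3 * Z) ≤ Yf s := by
    intro s hs
    rw [hYf, hZdef, ← neg_mul, ← MeasureTheory.integral_const_mul]
    refine setIntegral_mono_on (hZi.const_mul _) (hslici s) (measurableSet_zSlab P 0) fun x _ => ?_
    by_cases hx : cylRadius x ≤ ρ
    · have hb3 := hFb s hs x hx
      have hv : ε / 2 ≤ F s x := (half_le_self hε.le).trans hb3.1
      show -Real.log 3 * φ x ^ 2 ≤ H (F s x) * φ x ^ 2
      rw [hHeq _ hv]
      exact mul_le_mul_of_nonneg_right (neg_le_neg (Real.log_le_log (hε.trans_le hb3.1) hb3.2)) (sq_nonneg _)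
    · show -Real.log 3 * φ x ^ 2 ≤ H (F s x) * φ x ^ 2
      rw [hφ0 x (not_le.1 hx).le]; simp
  -- (D1) `R ≤ kK P`
  have hR1 : ∀ᵐ s ∂(volume.restrict (Ioc (-ρ ^ 2) 0)), Rf s ≤ kK * P := by
    filter_upwards [ae_restrict_mem measurableSet_Ioc] with s hsI
    have hs : s ∈ Icc (-ρ ^ 2) 0 := Ioc_subset_Icc_self hsI
    have hy := hYlo s hs
    have h1 : -(A / Z * Yf s) ≤ A * Real.log 3 := by
      have h2 : -(A / Z * Yf s) ≤ A / Z * (Real.log 3 * Z) := by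
        have := mul_le_mul_of_nonneg_left hy (div_nonneg hApos.le hZpos.le)
        linarith
      have e : A / Z * (Real.log 3 * Z) = A * Real.log 3 := by field_simp
      linarith
    have h4 := hGf0 s
    have e : kK * P = k₁ * P + A * Real.log 3 := by rw [hkK, hAdef]; ring
    rw [e]
    linarith [hslice s hs]
  -- the thresholds
  set Θ₁ : ℝ := k₁ * P * Z / A with hΘ₁
  set Θ : ℝ := max Θ₁ (2 * L₀ * Z) with hΘ
  have hΘpos : 0 < Θ := lt_of_lt_of_le (by positivity) (le_max_right _ _)
  -- (D3) above `Θ` the axis term absorbs the constant: `R ≤ −½ G ≤ 0`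
  have hR3' : ∀ s ∈ Icc (-ρ ^ 2) 0, Θ ≤ Yf s → Rf s ≤ -(1 / 2) * Gf s := by
    intro s hs hΘY
    have h1 : Θ₁ ≤ Yf s := (le_max_left _ _).trans hΘY
    have h2 : k₁ * P ≤ A / Z * Yf s := by
      have := mul_le_mul_of_nonneg_left h1 (div_nonneg hApos.le hZpos.le)
      have e : A / Z * Θ₁ = k₁ * P := by rw [hΘ₁]; field_simp
      linarith
    linarith [hslice s hs]
  have hR3 : ∀ᵐ s ∂(volume.restrict (Ioc (-ρ ^ 2) 0)), Θ ≤ Yf s → Rf s ≤ 0 := by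
    filter_upwards [ae_restrict_mem measurableSet_Ioc] with s hsI hΘY
    have := hR3' s (Ioc_subset_Icc_self hsI) hΘY
    have := hGf0 s
    linarith
  -- ### the set `W` of times of large mass
  obtain ⟨g, hgdef⟩ : ∃ g : ℝ → ℝ, ∀ s, g s = ∫ x in K₂, F s x ^ (1 / 4 : ℝ) := ⟨_, fun _ => rfl⟩
  have hgc : Continuous g := by
    have h := continuous_setIntegral_halfPeriodBox_rpow_quarter (P := P) (ρ := ρ) hFc
    exact h.congr fun s => (hgdef s).symm
  set W : Set ℝ := {s | θ₀ * (P * ρ ^ 2) ≤ g s} ∩ Ioc (-(ρ ^ 2 / 4)) 0 with hW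
  have hWm : MeasurableSet W := (isClosed_le continuous_const hgc).measurableSet.inter measurableSet_Ioc
  have hWsub : W ⊆ Ioc (-(ρ ^ 2 / 4)) 0 := inter_subset_right
  have hgG : ∀ s ∈ Ioc (-(ρ ^ 2 / 4)) 0, g s ≤ 3 * volume.real K₂ := by
    intro s hs
    have hsI : s ∈ Icc (-ρ ^ 2) 0 := ⟨hq1.trans hs.1.le, hs.2⟩
    have hpt : ∀ x ∈ K₂, F s x ^ (1 / 4 : ℝ) ≤ 3 := by
      intro x hx
      obtain ⟨hlo, hhi⟩ := hFb s hsI x (hx.2.trans hρρ.le)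
      have hF0 : 0 ≤ F s x := hε.le.trans hlo
      rcases le_or_gt 1 (F s x) with h1 | h1
      · calc F s x ^ (1 / 4 : ℝ) ≤ F s x ^ (1 : ℝ) := Real.rpow_le_rpow_of_exponent_le h1 (by norm_num)
          _ = F s x := Real.rpow_one _
          _ ≤ 3 := hhi
      · exact (Real.rpow_le_one hF0 h1.le (by norm_num)).trans (by norm_num)
    rw [hgdef]
    calc ∫ x in K₂, F s x ^ (1 / 4 : ℝ) ≤ ∫ x in K₂, (3 : ℝ) :=
          setIntegral_mono_on (((hF2 s).continuous.rpow_const fun x => Or.inr (by norm_num)).continuousOn.integrableOn_compact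
            hK₂c) (integrableOn_const hK₂top) hK₂m hpt
      _ = 3 * volume.real K₂ := by rw [setIntegral_const, smul_eq_mul, mul_comm]
  have hmW : m₀ * (P * ρ ^ 4) ≤ ∫ s in Ioc (-(ρ ^ 2 / 4)) 0, g s := by
    rw [← intervalIntegral.integral_of_le hq0]
    refine hmass.trans (le_of_eq (intervalIntegral.integral_congr fun s _ => (hgdef s).symm))
  have hGm : 0 < 3 * volume.real K₂ := by positivity
  have hWvol0 := measureReal_superlevel_ge hgc hq0 (θ := θ₀ * (P * ρ ^ 2)) (by positivity) hGm hgG hmW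
  have hWvol : γ * ρ ^ 2 ≤ volume.real W := by
    refine le_trans ?_ hWvol0
    have e : m₀ * (P * ρ ^ 4) - θ₀ * (P * ρ ^ 2) * (0 - -(ρ ^ 2 / 4)) = m₀ * P * ρ ^ 4 / 2 := by rw [hθ₀]; ring
    rw [e]
    calc γ * ρ ^ 2 = m₀ * P * ρ ^ 4 / 2 / (3 * (ρ ^ 2 * P)) := by rw [hγ]; field_simp; norm_num
      _ ≤ m₀ * P * ρ ^ 4 / 2 / (3 * volume.real K₂) :=
          div_le_div_of_nonneg_left (by positivity) hGm (mul_le_mul_of_nonneg_left hVhi (by norm_num))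
  -- (D2) on `W`, above `Θ`: Nash–Poincaré gives `R ≤ −a₀ Y²`
  set a₀ : ℝ := w₀ ^ 2 / (36864 * ρ ^ 2 * Z) / 2 with ha₀
  have ha₀pos : 0 < a₀ := by positivity
  have hR2 : ∀ᵐ s ∂(volume.restrict (Ioc (-ρ ^ 2) 0)), s ∈ W → Θ ≤ Yf s → Rf s ≤ -(a₀ * Yf s ^ 2) := by
    filter_upwards [ae_restrict_mem measurableSet_Ioc] with s hsI hsW hΘY
    have hsIcc : s ∈ Icc (-ρ ^ 2) 0 := Ioc_subset_Icc_self hsI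
    -- the mass on the half period box at this time
    have hgs : θ₀ * (P * ρ ^ 2) ≤ ∫ x in K₂, F s x ^ (1 / 4 : ℝ) := by rw [← hgdef]; exact hsW.1
    have hF0 : ∀ x, cylRadius x ≤ ρ → 0 ≤ F s x := fun x hx => hε.le.trans (hFb s hsIcc x hx).1
    have hsm := slab_mass_of_quarter_mass_periodic hP hρ (hF2 s).continuous hF0 (by positivity) hgs
    have hmass_s : w₀ * Z ≤ ∫ x in zSlab P 0, F s x * φ x ^ 2 := by
      have e : 16 / 27 * (θ₀ * (P * ρ ^ 2)) ^ 4 / (ρ ^ 2 * P) ^ 3 = m₁ * (ρ ^ 2 * P) := by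
        rw [hm₁]; field_simp
      rw [e] at hsm
      have h1 : w₀ * Z ≤ m₁ * (ρ ^ 2 * P) := by
        rw [hw₀]
        calc m₁ / 4 * Z ≤ m₁ / 4 * (4 * ρ ^ 2 * P) := mul_le_mul_of_nonneg_left hZV (by positivity)
          _ = m₁ * (ρ ^ 2 * P) := by ring
      exact h1.trans hsm
    have hYs : 2 * L₀ * Z ≤ Yf s := (le_max_right _ _).trans hΘY
    have hNP := nash_poincare_lower_periodic hP hPρ hε ((hF2 s).of_le one_le_two) (hFp s) (hFb s hsIcc) hH1 hHeq
      hw₀0 hL₀0.le hL₀' (by rw [← hφdef, ← hZdef]; exact hmass_s) (by rw [← hφdef, ← hZdef, ← hYf]; exact hYs)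
    rw [← hφdef, ← hZdef, ← hYf, ← hGf] at hNP
    have h1 := hR3' s hsIcc hΘY
    rw [ha₀]
    have e : w₀ ^ 2 / (36864 * ρ ^ 2 * Z) / 2 * Yf s ^ 2 = (1 / 2) * (w₀ ^ 2 / (36864 * ρ ^ 2 * Z) * Yf s ^ 2) := by
      ring
    rw [e]
    linarith
  -- ### the time argument
  have hT0 : 0 < ρ ^ 2 := by positivity
  have hKP : 0 ≤ kK * P := by positivity
  have htime := le_threshold_or_riccati (Y := Yf) (R := Rf) (T := ρ ^ 2) (K := kK * P) hT0 hKP hΘpos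
    ha₀pos hγ0 hRi hY hWm hWsub hWvol hR1 hR2 hR3
  -- ### conclusion
  have htI : t ∈ Icc (-(γ * ρ ^ 2 / 2)) 0 := by
    refine ⟨le_trans ?_ ht.1, ht.2⟩
    have : ct * ρ ^ 2 ≤ γ / 2 * ρ ^ 2 := mul_le_mul_of_nonneg_right (min_le_left _ _) (sq_nonneg _)
    linarith
  have hYt := htime t htI
  have htIcc : t ∈ Icc (-ρ ^ 2) 0 := by
    refine ⟨le_trans ?_ ht.1, ht.2⟩
    have : ct * ρ ^ 2 ≤ 1 / 8 * ρ ^ 2 := mul_le_mul_of_nonneg_right (min_le_right _ _) (sq_nonneg _)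
    nlinarith
  -- `∫_{slab} (−log F t) φ² = Y t`
  have hYeq : ∫ x in zSlab P 0, -Real.log (F t x) * φ x ^ 2 = Yf t := by
    rw [hYf]
    refine setIntegral_congr_fun (measurableSet_zSlab P 0) fun x _ => ?_
    show -Real.log (F t x) * φ x ^ 2 = H (F t x) * φ x ^ 2
    by_cases hx : cylRadius x ≤ ρ
    · rw [hHeq _ ((half_le_self hε.le).trans (hFb t htIcc x hx).1)]
    · rw [hφ0 x (not_le.1 hx).le]; simp
  rw [hYeq]
  refine hYt.trans ?_
  -- the constants: `max Θ (2/(a₀γρ²)) + kK P ρ² ≤ M₀ P ρ²`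
  have hΘ₁le : Θ₁ ≤ 2 * k₁ / radialConst₂ * (P * ρ ^ 2) := by
    rw [hΘ₁, hAdef]
    have e : k₁ * P * Z / (2 * radialConst₂ * P) = k₁ / (2 * radialConst₂) * Z := by field_simp
    rw [e]
    calc k₁ / (2 * radialConst₂) * Z ≤ k₁ / (2 * radialConst₂) * (4 * ρ ^ 2 * P) :=
          mul_le_mul_of_nonneg_left hZV (by positivity)
      _ = 2 * k₁ / radialConst₂ * (P * ρ ^ 2) := by field_simp; ring
  have hΘ₂le : 2 * L₀ * Z ≤ 8 * L₀ * (P * ρ ^ 2) := by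
    calc 2 * L₀ * Z ≤ 2 * L₀ * (4 * ρ ^ 2 * P) := mul_le_mul_of_nonneg_left hZV (by positivity)
      _ = 8 * L₀ * (P * ρ ^ 2) := by ring
  have hΘle : Θ ≤ (2 * k₁ / radialConst₂ + 8 * L₀) * (P * ρ ^ 2) := by
    rw [hΘ]
    refine max_le ?_ ?_
    · have : 0 ≤ 8 * L₀ * (P * ρ ^ 2) := by positivity
      linarith
    · have : 0 ≤ 2 * k₁ / radialConst₂ * (P * ρ ^ 2) := by positivity
      linarith
  have hRic : 2 / (a₀ * γ * ρ ^ 2) ≤ 589824 / (w₀ ^ 2 * γ) * (P * ρ ^ 2) := by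
    rw [ha₀]
    have e : 2 / (w₀ ^ 2 / (36864 * ρ ^ 2 * Z) / 2 * γ * ρ ^ 2) = 147456 / (w₀ ^ 2 * γ) * Z := by
      field_simp
      ring
    rw [e]
    calc 147456 / (w₀ ^ 2 * γ) * Z ≤ 147456 / (w₀ ^ 2 * γ) * (4 * ρ ^ 2 * P) :=
          mul_le_mul_of_nonneg_left hZV (by positivity)
      _ = 589824 / (w₀ ^ 2 * γ) * (P * ρ ^ 2) := by ring
  have hmax : max Θ (2 / (a₀ * γ * ρ ^ 2)) ≤
      (2 * k₁ / radialConst₂ + 8 * L₀ + 589824 / (w₀ ^ 2 * γ)) * (P * ρ ^ 2) := by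
    refine max_le ?_ ?_
    · have : 0 ≤ 589824 / (w₀ ^ 2 * γ) * (P * ρ ^ 2) := by positivity
      linarith
    · have : 0 ≤ (2 * k₁ / radialConst₂ + 8 * L₀) * (P * ρ ^ 2) := by positivity
      linarith
  rw [hM₀]
  have e : kK * P * ρ ^ 2 = kK * (P * ρ ^ 2) := by ring
  rw [e]
  linarith [hmax]

end LeiRenZhang2019

end Literature.Analysis.FluidPDE

end
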